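import Summits.Ventures.PercRepro.RankLevelSetRuleQUntruncated

/-!
# PercRepro — (R̂) FROM A PAIRING CERTIFICATE: `k − 1` BINOMIAL INEQUALITIES DECIDE ANY UNTRUNCATED SLICE
(p4, gen 22; C-044; paper proofs/P4-CELL-THREE.md §11.5)

`rhat_ge_phiK_of_pairing (q k m) (2 ≤ k) (k − 1 ≤ q − m) (m ≤ q) (hpair) : phiK (q + k) q ≤ rhat q k m`, where `hpair` says,
for every `0 < J < k`, `C(m, J)·C(q+J+k−1, J+k−1) ≤ N_{J+k−1}·C(q+J, J)` with `N_{J'} = Σ_{0<i<k, i≤J', J'−i≤m} C(q+k−m, i)·C(m, J'−i)`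
(the `J`-th row term against the WHOLE diagonal `J + k − 1` of the exact form `rhat_sub_phiK_eq`).  The hypothesis is a
conjunction of `k − 1` inequalities between binomial coefficients in `ℕ` — for a given `(q, k, m)` the kernel decides it in
seconds (`Nat.choose_eq_descFactorial_div_factorial` + `decide +kernel`), whereas evaluating `R̂` itself costs `(k−1)(m+1)` rational
terms.  Two points far outside every regime proved so far are certified this way: the slice `#P = 30` of the cell `(45, 40)`
(`k = 5`) and `#P = 150` of `(210, 200)` (`k = 10`).  Numerically the certificate holds on the regime `#P ≲ (k−1)q/k`
(paper §11.2, §11.4: the binding inequality is `J = 1`, in closed form `F(u, m, k) ≥ 0`), so this module is the assembly half of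
the candidate theorem for that regime; RankLevelSetRuleQSmallFlat is the same assembly with the single `i = k − 1` term of each
diagonal (regime `k·#P ≤ q + k`, proved uniformly).  Axioms: standard.
-/

namespace PercRepro

open Finset

/-- **(R̂) FROM A PAIRING CERTIFICATE** (untruncated regime `k − 1 ≤ q − m`, `k ≥ 2`): if for every `0 < J < k`
the row term `C(m, J)·C(q+J+k−1, J+k−1)` is at most the whole diagonal `J + k − 1` times `C(q+J, J)`
(`k − 1` inequalities in `ℕ`, decidable for any given `(q, k, m)`), then `Φ(q+k, q) ≤ R̂(q, k, m)`. -/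
theorem rhat_ge_phiK_of_pairing (q k m : ℕ) (hk : 2 ≤ k) (hu : k - 1 ≤ q - m) (hm : m ≤ q)
    (hpair : ∀ J ∈ Ioo 0 k,
      m.choose J * (q + (J + (k - 1))).choose (J + (k - 1))
        ≤ (∑ i ∈ Ioo 0 k, (if i ≤ J + (k - 1) ∧ J + (k - 1) - i ≤ m
            then (q + k - m).choose i * m.choose (J + (k - 1) - i) else 0)) * (q + J).choose J) :
    phiK (q + k) q ≤ rhat q k m := by
  rw [rhat_ge_phiK_iff_untrunc q k m (by omega) hu hm]
  rw [sum_Ioo_nat, show k - (0 + 1) = k - 1 by omega]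
  set f : ℕ → ℚ := fun J => (m.choose (0 + 1 + J) : ℚ) * (1 / ((q + (0 + 1 + J)).choose (0 + 1 + J) : ℚ)) with hf
  set g : ℕ → ℚ := fun J => (1 / ((q + (k + J)).choose (k + J) : ℚ)) * ∑ i ∈ Ioo 0 k,
      (if i ≤ k + J ∧ k + J - i ≤ m then ((q + k - m).choose i : ℚ) * (m.choose (k + J - i) : ℚ) else 0) with hg
  have hfg : ∀ J ∈ range (k - 1), f J ≤ g J := by
    intro J hJ
    rw [Finset.mem_range] at hJ
    have h := hpair (J + 1) (by rw [Finset.mem_Ioo]; omega)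
    rw [show J + 1 + (k - 1) = k + J by omega] at h
    have hX : (0 : ℚ) < ((q + (J + 1)).choose (J + 1) : ℚ) := by exact_mod_cast Nat.choose_pos (by omega)
    have hY : (0 : ℚ) < ((q + (k + J)).choose (k + J) : ℚ) := by exact_mod_cast Nat.choose_pos (by omega)
    have h' : ((m.choose (J + 1) : ℕ) : ℚ) * ((q + (k + J)).choose (k + J) : ℚ)
        ≤ ((∑ i ∈ Ioo 0 k, (if i ≤ k + J ∧ k + J - i ≤ m
            then (q + k - m).choose i * m.choose (k + J - i) else 0) : ℕ) : ℚ) * ((q + (J + 1)).choose (J + 1) : ℚ) := by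
      exact_mod_cast h
    push_cast at h'
    simp only [hf, hg, show 0 + 1 + J = J + 1 by ring]
    rw [mul_one_div, one_div_mul_eq_div, div_le_div_iff₀ hX hY]
    linarith
  have hg0 : ∀ J, m ≤ J → g J = 0 := by
    intro J hJ
    simp only [hg]
    rw [Finset.sum_eq_zero (fun i hi => ?_), mul_zero]
    rw [Finset.mem_Ioo] at hi
    rw [if_neg (fun h => by omega)]
  have hgnn : ∀ J, 0 ≤ g J := by
    intro J
    simp only [hg]
    refine mul_nonneg (by positivity) (Finset.sum_nonneg (fun i _ => ?_))
    split_ifs <;> positivity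
  calc ∑ J ∈ range (k - 1), f J ≤ ∑ J ∈ range (k - 1), g J := Finset.sum_le_sum hfg
    _ ≤ ∑ J ∈ range (k - 1 + m), g J :=
        Finset.sum_le_sum_of_subset_of_nonneg
          (fun x hx => by rw [Finset.mem_range] at hx ⊢; omega) (fun J _ _ => hgnn J)
    _ = ∑ J ∈ range m, g J := by
        rw [← Finset.sum_range_add_sum_Ico _ (show m ≤ k - 1 + m by omega)]
        rw [Finset.sum_eq_zero (fun J hJ => hg0 J (Finset.mem_Ico.1 hJ).1), add_zero]
    _ = ∑ J' ∈ Ico k (k + m), (1 / ((q + J').choose J' : ℚ)) * ∑ i ∈ Ioo 0 k,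
          (if i ≤ J' ∧ J' - i ≤ m then ((q + k - m).choose i : ℚ) * (m.choose (J' - i) : ℚ) else 0) := by
        rw [Finset.sum_Ico_eq_sum_range, show k + m - k = m by omega]


/-- **A kernel-certified point far outside the small-flat regime**: the slice `#P = 30` of the cell `(45, 40)` (`k = 5`,
`u = 10`; `k·#P = 150 > q + k = 45`; `R̂/Φ = 1.4559…`) — the four pairing inequalities decided by the kernel. -/
theorem rhat_forty_five_thirty : phiK (40 + 5) 40 ≤ rhat 40 5 30 := by
  refine rhat_ge_phiK_of_pairing 40 5 30 (by norm_num) (by norm_num) (by norm_num) ?_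
  simp only [Nat.choose_eq_descFactorial_div_factorial]
  decide +kernel

/-- **A second point**: `#P = 150` of the cell `(210, 200)` (`k = 10`, `u = 50`; `k·#P = 1500 > 210`; `R̂/Φ = 1.6565…`). -/
theorem rhat_two_hundred_ten_onefifty : phiK (200 + 10) 200 ≤ rhat 200 10 150 := by
  refine rhat_ge_phiK_of_pairing 200 10 150 (by norm_num) (by norm_num) (by norm_num) ?_
  simp only [Nat.choose_eq_descFactorial_div_factorial]
  decide +kernel

end PercRepro
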